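import Summits.MatrixMultiplication.OmegaCensus.SmallFormats.MatMul22nRankGF7PatternDFS
import HarnessLib

/-!
# ω-census family (a): normalising the torus-0 column of a point of the `𝔽₇` X-cap system by left multiplication

Cell `pub-omega` (unit `pub-omega-tensor-g15`), topic `Summits/MatrixMultiplication/OmegaCensus` (sub-folder `SmallFormats`).
Framing (verbatim): lottery ticket; floor = certified bounds/negative ranges. HONEST FRAMING: kernel infrastructure (the WLOG step of
`pub-omega-tensor-g15/KERNEL-S4-DESIGN.md`); word tables generated by `pub-omega-tensor-g15/code/gen_normalise.py`; nothing here is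
progress on `ω`.

For a point `x` of the rows of `xcapSys7s s` let `colN7 x j z` be its torus-`j` column (the row sum of the coset row `cosetRow7 j z`).
Relabelling by a generator word `w` (`xLmulW7 w x`, `MatMul22nRankGF7LeftMul`) keeps feasibility, box and total and composes the columns with
the action `lmulOmW7 w` on `Ω`. TABLES (kernel-checked): `trWord7 t` moves `z₀ = 18` to `t` (transitivity on `Ω`); `k0Word7 i` fixes `z₀`,
moves `z₁ = 0` to the `i`-th point of the orbit `O₁` and preserves `O₁`; `invWord7 w` inverts a word (generator orders `8` and `7`).
RESULT (`exists_norm_word7`): for every point there is a word making its torus-`0` column NORMALISED (`IsNorm7`); and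
(`col_eq_of_rep7`) if a column is `repVal ∘ lmulOmW7 w` then after relabelling by `invWord7 w` it IS `repVal`.
-/

namespace Summit.MatrixMultiplication.OmegaCensus.SmallFormats

open Finset

/-! ## Natural-number columns -/

/-- The torus-`j` column of the point `x` at `z`, as a natural number (row sum of the coset row). -/
def colN7 (x : ℕ → ℕ) (j z : ℕ) : ℕ := ((rowList7 (cosetRow7 j z)).map x).sum

/-- Natural row sum of a row list. -/
theorem natRowSum_cast7 (x : ℕ → ℕ) (r : ℕ) : ((((rowList7 r).map x).sum : ℕ) : ℤ) = xrs7 x r := by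
  unfold xrs7
  rw [Nat.cast_list_sum, List.map_map]
  rfl

/-- The natural column casts to the integer column `xrs7 x (cosetRow7 j z)`. -/
theorem colN7_cast (x : ℕ → ℕ) (j z : ℕ) : ((colN7 x j z : ℕ) : ℤ) = xrs7 x (cosetRow7 j z) := natRowSum_cast7 x _

/-- Columns of a relabelled point: `colN7 (xLmulW7 w x) j z = colN7 x j (lmulOmW7 w z)` (with the hypotheses of `lmulW7_spec`). -/
theorem colN7_lmulW7 {w : List ℕ} (hw : ∀ k ∈ w, k < 2) {s : ℕ} {x : ℕ → ℕ} (hbox : ∀ j, x j ≤ s)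
    (hrows : ∀ r < 1274, capRowVal7 x r ≤ rhs7s s r) {j z : ℕ} (hj : j < 21) (hz : z < 42) :
    lmulOmW7 w z < 42 ∧ colN7 (xLmulW7 w x) j z = colN7 x j (lmulOmW7 w z) := by
  obtain ⟨_, _, _, h4⟩ := lmulW7_spec w hw x hbox hrows
  obtain ⟨hlt, heq⟩ := h4 j z hj hz
  refine ⟨hlt, ?_⟩
  have e : ((colN7 (xLmulW7 w x) j z : ℕ) : ℤ) = ((colN7 x j (lmulOmW7 w z) : ℕ) : ℤ) := by rw [colN7_cast, colN7_cast, heq]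
  exact_mod_cast e

/-! ## Word tables -/

/-- Transitivity words: `20`-bit fields, length (`4` bits) + letters. -/
def trTab7 : ℕ := 42461969739556863053842907310313676826026743810820182962061332685570558149053275182180136961300508761095770739928734101068918985270604196429599695269168863438026758690686176229900963856243577117404853326253814050432334597692313348344451073668956555015
/-- `trWord7 t`: a generator word whose action moves `z₀` to `t`. -/
def trWord7 (t : ℕ) : List ℕ := (List.range (fld 20 trTab7 t % 2 ^ 4)).map fun i => fld 20 trTab7 t / 2 ^ (4 + i) % 2
/-- Stabiliser words: `20`-bit fields. -/
def k0Tab7 : ℕ := 115685118375838669720158128848812231967637504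
/-- `k0Word7 i`: a generator word fixing `z₀`, moving `z₁` to the `i`-th point of `O₁`, preserving `O₁`. -/
def k0Word7 (i : ℕ) : List ℕ := (List.range (fld 20 k0Tab7 i % 2 ^ 4)).map fun i' => fld 20 k0Tab7 i / 2 ^ (4 + i') % 2

set_option maxRecDepth 100000 in
/-- Transitivity table check. -/
theorem trWord7_ok : ∀ t : Fin 42, (∀ k ∈ trWord7 t.val, k < 2) ∧ lmulOmW7 (trWord7 t.val) 18 = t.val := by decide

set_option maxRecDepth 100000 in
/-- Stabiliser table check (`orbO1_7 0 = z₁`, orbit points `< 42`). -/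
theorem k0Word7_ok : orbO1_7 0 = 0 ∧ (∀ i : Fin 8, orbO1_7 i.val < 42) ∧ ∀ i : Fin 8, (∀ k ∈ k0Word7 i.val, k < 2) ∧
    lmulOmW7 (k0Word7 i.val) 18 = 18 ∧ lmulOmW7 (k0Word7 i.val) 0 = orbO1_7 i.val ∧
    ∀ i' : Fin 8, ∃ i'' : Fin 8, lmulOmW7 (k0Word7 i.val) (orbO1_7 i'.val) = orbO1_7 i''.val := by
  refine ⟨by decide, by decide, by decide⟩

/-! ## Words: concatenation and inverses -/

/-- Action of a concatenation. -/
theorem lmulOmW7_append (w w' : List ℕ) (z : ℕ) : lmulOmW7 (w ++ w') z = lmulOmW7 w (lmulOmW7 w' z) := by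
  induction w with
  | nil => rfl
  | cons k w ih => simp [lmulOmW7, ih]

/-- Relabelling by a concatenation. -/
theorem xLmulW7_append (w w' : List ℕ) (x : ℕ → ℕ) : xLmulW7 (w ++ w') x = xLmulW7 w' (xLmulW7 w x) := by
  induction w generalizing x with
  | nil => rfl
  | cons k w ih => simp [xLmulW7, ih]

set_option maxRecDepth 100000 in
/-- The generators have orders `8` and `7` on `Ω`. -/
theorem gen_order7 : ∀ z : Fin 42, lmulOmW7 (List.replicate 8 0) z.val = z.val ∧ lmulOmW7 (List.replicate 7 1) z.val = z.val := by
  decide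

/-- A generator letter maps `Ω` to `Ω`. -/
theorem lmulOm7_lt {k z : ℕ} (hk : k < 2) (hz : z < 42) : lmulOm7 k z < 42 :=
  (lmulCoset7_ok ⟨k, hk⟩ ⟨0, by norm_num⟩ ⟨z, hz⟩).2

/-- A word maps `Ω` to `Ω`. -/
theorem lmulOmW7_lt {w : List ℕ} (hw : ∀ k ∈ w, k < 2) {z : ℕ} (hz : z < 42) : lmulOmW7 w z < 42 := by
  induction w with
  | nil => exact hz
  | cons k w ih =>
    have hk : k < 2 := hw k (by simp)
    exact lmulOm7_lt hk (ih fun k' hk' => hw k' (by simp [hk']))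

/-- Inverse of a letter: `7` more copies of generator `0`, `6` more copies of generator `1`. -/
def invLetter7 (k : ℕ) : List ℕ := List.replicate (if k = 0 then 7 else 6) k
/-- Inverse word. -/
def invWord7 : List ℕ → List ℕ
  | [] => []
  | k :: w => invWord7 w ++ invLetter7 k

/-- Letters of an inverse word. -/
theorem invWord7_letters {w : List ℕ} (hw : ∀ k ∈ w, k < 2) : ∀ k ∈ invWord7 w, k < 2 := by
  induction w with
  | nil => simp [invWord7]
  | cons a w ih =>
    intro k hk
    simp only [invWord7, List.mem_append, invLetter7, List.mem_replicate] at hk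
    rcases hk with hk | ⟨_, rfl⟩
    · exact ih (fun k' hk' => hw k' (by simp [hk'])) k hk
    · exact hw k (by simp)

/-- A letter followed by its inverse acts trivially on `Ω`. -/
theorem letter_inv7 {k z : ℕ} (hk : k < 2) (hz : z < 42) : lmulOm7 k (lmulOmW7 (invLetter7 k) z) = z := by
  have h8 := (gen_order7 ⟨z, hz⟩).1
  have h7 := (gen_order7 ⟨z, hz⟩).2
  interval_cases k
  · -- 8 copies of 0
    have e : lmulOmW7 (List.replicate 8 0) z = lmulOm7 0 (lmulOmW7 (invLetter7 0) z) := rfl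
    rw [← e]; exact h8
  · have e : lmulOmW7 (List.replicate 7 1) z = lmulOm7 1 (lmulOmW7 (invLetter7 1) z) := rfl
    rw [← e]; exact h7

/-- **A word followed by its inverse acts trivially on `Ω`.** -/
theorem word_inv7 {w : List ℕ} (hw : ∀ k ∈ w, k < 2) {z : ℕ} (hz : z < 42) : lmulOmW7 w (lmulOmW7 (invWord7 w) z) = z := by
  induction w generalizing z with
  | nil => rfl
  | cons k w ih =>
    have hk : k < 2 := hw k (by simp)
    have hw' : ∀ k' ∈ w, k' < 2 := fun k' hk' => hw k' (by simp [hk'])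
    show lmulOm7 k (lmulOmW7 w (lmulOmW7 (invWord7 w ++ invLetter7 k) z)) = z
    rw [lmulOmW7_append, ih hw' (lmulOmW7_lt (by
      intro k' hk'; simp only [invLetter7, List.mem_replicate] at hk'; obtain ⟨_, rfl⟩ := hk'; exact hk) hz)]
    exact letter_inv7 hk hz

/-! ## Normalisation -/

/-- **Normalising word.** For every point of the rows of `xcapSys7s s` (box `s`) there is a generator word `W` such that the torus-`0`
column of the relabelled point is normalised: minimal at `z₀`, and minimal over `O₁` at `z₁`. -/
theorem exists_norm_word7 {s : ℕ} (x : ℕ → ℕ) (hbox : ∀ j, x j ≤ s) (hrows : ∀ r < 1274, capRowVal7 x r ≤ rhs7s s r) :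
    ∃ W : List ℕ, (∀ k ∈ W, k < 2) ∧ IsNorm7 (colN7 (xLmulW7 W x) 0) := by
  obtain ⟨hO0, hOlt, hK⟩ := k0Word7_ok
  -- step 1: move a minimising point to z₀
  obtain ⟨t, ht, htmin⟩ := exists_min_image (range 42) (fun z => colN7 x 0 z) ⟨0, by simp⟩
  have ht42 : t < 42 := mem_range.1 ht
  obtain ⟨hW1, hW1act⟩ := trWord7_ok ⟨t, ht42⟩
  set x1 := xLmulW7 (trWord7 t) x with hx1
  have hc1 : ∀ z < 42, lmulOmW7 (trWord7 t) z < 42 ∧ colN7 x1 0 z = colN7 x 0 (lmulOmW7 (trWord7 t) z) :=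
    fun z hz => colN7_lmulW7 hW1 hbox hrows (by norm_num) hz
  have hmin1 : ∀ z < 42, colN7 x1 0 18 ≤ colN7 x1 0 z := by
    intro z hz
    obtain ⟨hl, he⟩ := hc1 z hz
    obtain ⟨_, he0⟩ := hc1 18 (by norm_num)
    rw [he, he0, hW1act]
    exact htmin _ (mem_range.2 hl)
  -- step 2: inside the stabiliser of z₀, move an O₁-minimising point to z₁
  obtain ⟨sp1, sp2, _, _⟩ := lmulW7_spec (trWord7 t) hW1 x hbox hrows
  obtain ⟨i, hi, himin⟩ := exists_min_image (range 8) (fun i => colN7 x1 0 (orbO1_7 i)) ⟨0, by simp⟩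
  have hi8 : i < 8 := mem_range.1 hi
  obtain ⟨hW2, hfix, hmove, hperm⟩ := hK ⟨i, hi8⟩
  refine ⟨trWord7 t ++ k0Word7 i, ?_, ?_⟩
  · intro k hk; rw [List.mem_append] at hk
    rcases hk with hk | hk
    · exact hW1 k hk
    · exact hW2 k hk
  rw [xLmulW7_append]
  have hc2 : ∀ z < 42, lmulOmW7 (k0Word7 i) z < 42 ∧ colN7 (xLmulW7 (k0Word7 i) x1) 0 z = colN7 x1 0 (lmulOmW7 (k0Word7 i) z) :=
    fun z hz => colN7_lmulW7 hW2 sp1 sp2 (by norm_num) hz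
  constructor
  · intro z hz
    obtain ⟨hl, he⟩ := hc2 z hz
    obtain ⟨_, he0⟩ := hc2 18 (by norm_num)
    rw [he, he0]
    have hfix' : lmulOmW7 (k0Word7 i) 18 = 18 := hfix
    rw [hfix']
    exact hmin1 _ hl
  · intro i' hi'
    obtain ⟨i'', hi''⟩ := hperm ⟨i', hi'⟩
    obtain ⟨_, he⟩ := hc2 (orbO1_7 i') (hOlt ⟨i', hi'⟩)
    obtain ⟨_, he1⟩ := hc2 0 (by norm_num)
    rw [he, he1]
    have hmove' : lmulOmW7 (k0Word7 i) 0 = orbO1_7 i := hmove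
    have hi''' : lmulOmW7 (k0Word7 i) (orbO1_7 i') = orbO1_7 i''.val := hi''
    rw [hmove', hi''']
    exact himin _ (mem_range.2 i''.isLt)

/-- **Undoing a word.** If the torus-`0` column of `x` is `R ∘ lmulOmW7 w`, then after relabelling by `invWord7 w` it is `R` itself. -/
theorem col_eq_of_rep7 {s : ℕ} (x : ℕ → ℕ) (hbox : ∀ j, x j ≤ s) (hrows : ∀ r < 1274, capRowVal7 x r ≤ rhs7s s r)
    {w : List ℕ} (hw : ∀ k ∈ w, k < 2) (R : ℕ → ℕ) (hR : ∀ z < 42, colN7 x 0 z = R (lmulOmW7 w z)) :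
    ∀ z < 42, colN7 (xLmulW7 (invWord7 w) x) 0 z = R z := by
  intro z hz
  obtain ⟨hl, he⟩ := colN7_lmulW7 (invWord7_letters hw) hbox hrows (j := 0) (by norm_num) hz
  rw [he, hR _ hl, word_inv7 hw hz]

end Summit.MatrixMultiplication.OmegaCensus.SmallFormats
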